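import Summits.ABC.IUTFork.Cor312PilotIdelesMRead
import HarnessLib

/-!
# [IUTchIII] Corollary 3.12, statement — the pilot ideles at the M-level presentation are units of norm `1` OFF THE
# FINITE SET OF RATIONAL PLACES UNDER `V^bad_mod` (G1-Θ unit P4a, fourth file: the FINITE-SET form `u ∉ S → ‖t u x‖ = 1`
# of the side conditions `ht1`/`htq1` that abc-iut-w5-d166's `settingMSharp` (p435453) binds)

Record-only file (D-0012) of the abc-iut cell (seat abc-iut-w5-d033, gen 9; branch C «abc ⇐ S», C-R12 (e) target #2′).
TAKES NO SIDE on [IUTchIII] Cor. 3.12. PROOF-ONLY sequel of `Cor312PilotIdelesMRead` (p436273). The M-level sharp setting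
`settingMSharp … t tq htq0 Sq htq1` binds the `q`-side unit condition in the shape
`htq1 : ∀ u x, u ∉ Sq → ‖tq u x‖ = 1` for a finite set `Sq` of finite places of `ℚ` (and the Θ-side finiteness likewise).
For the GENUINE ideles `tqM`/`tThetaM` of idele data `r` of `D` the set is **the rational places under `V^bad_mod`**,
`(badPrimesMod D).image (v ↦ 𝔭_v ∩ ℤ)` (no new definition: the `Finset` term is used verbatim, classical decidability) or,
instance-free, the hypothesis `∀ v ∈ badPrimesMod D, (𝔭_v ∩ ℤ) ≠ u`:

* `mk_under_placeModOfM` — the place of `ℚ` below `v(x)` is `u`; `placeModOfM_not_mem_of_forall_ne`,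
  `mem_image_of_placeModOfM_mem` — bookkeeping between the two shapes;
* **`norm_tqM_eq_one_of_forall_ne`** / **`norm_tThetaM_eq_one_of_forall_ne`** (instance-free) and
  **`norm_tqM_eq_one_of_not_mem_image`** / **`norm_tThetaM_eq_one_of_not_mem_image`** (`u ∉ Finset.image …` verbatim):
  for `u` NOT under a bad prime, EVERY member `x` of the fibre over `u` has `‖tqM … x‖ = 1`, `‖tThetaM … i x‖ = 1`
  (p436273's per-member lemmas + the place-below identity `under_rat_eq_maximalIdeal`); `…_ideleDataOf` forms on a
  volume input `I`.

[cite: Mochizuki2012, IUTchI Def. 3.1 (b)(e) p. 61–62] [cite: DupuyHilado2025, §3.3, §3.4]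
[claim: Mochizuki2012, status: disputed] for the quoted setting. HONEST FRAMING: bookkeeping over OUR typed objects;
nothing here bears on the truth of [IUTchIII] Cor. 3.12; typed ≠ proved; instantiated ≠ endorsed.
-/

noncomputable section

open Set Function NumberField IsDedekindDomain
open scoped Pointwise

namespace Summit.ABC.IUTFork.Thm311.Real

open Cor312Vol Literature.IUT.LogThetaLattice Literature.IUT.LogVolume Literature.IUT.HodgeTheaters
  Literature.NumberTheory.NumberFields

variable {F K Fbar : Type} [Field F] [NumberField F] [Field K] [NumberField K] [Algebra F K]
  [Field Fbar] [Algebra F Fbar] [Algebra K Fbar] {E : WeierstrassCurve F} [E.IsElliptic] {l : ℕ}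
  {Pb : BadPlacePredicates K} (D : InitialThetaData F K Fbar E l Pb)
  (p : ℕ) [hp : Fact p.Prime] (u : FinitePlace ℚ) (hu : ((p : ℕ) : 𝓞 ℚ) ∈ (FinitePlace.maximalIdeal u).asIdeal)

omit hp in
include hu in
/-- The place of `ℚ` under the place `v(x)` of `F_mod` under a member `x` of the fibre over `u` IS `u`.
[cite: Mochizuki2012, IUTchI Def. 3.1 (e) p. 62] -/
theorem mk_under_placeModOfM [Fact p.Prime] (x : (thetaIndexOfInitial D).Fibre (Val.non u)) :
    FinitePlace.mk ((placeModOfM D u x).under (𝓞 ℚ)) = u := by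
  have h := under_rat_eq_maximalIdeal (E := E) p u hu (placeOverOfFibreM D p u hu x)
  rw [placeOverOfFibreM_val] at h
  rw [h, FinitePlace.mk_maximalIdeal]

omit hp in
include hu in
/-- If `u` is not the place below any bad prime of `F_mod`, the place `v(x)` under every member `x` of the fibre over `u`
is not bad (instance-free form of "`u ∉` the rational places under `V^bad_mod`"). [cite: Mochizuki2012, IUTchI Def. 3.1 (b)(e) p. 61–62] -/
theorem placeModOfM_not_mem_of_forall_ne [Fact p.Prime] (x : (thetaIndexOfInitial D).Fibre (Val.non u))
    (hS : ∀ v ∈ ThetaData.badPrimesMod D, FinitePlace.mk (v.under (𝓞 ℚ)) ≠ u) :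
    placeModOfM D u x ∉ (ThetaData.pilotData D).S :=
  fun hx => hS _ hx (mk_under_placeModOfM D p u hu x)

open scoped Classical in
omit hp in
include hu in
/-- If the place `v(x)` of `F_mod` under a member `x` of the fibre over `u` is bad, then `u` is under a bad prime
(`Finset.image` form, classical decidability). [cite: Mochizuki2012, IUTchI Def. 3.1 (b)(e) p. 61–62] -/
theorem mem_image_of_placeModOfM_mem [Fact p.Prime] (x : (thetaIndexOfInitial D).Fibre (Val.non u))
    (hx : placeModOfM D u x ∈ ThetaData.badPrimesMod D) :
    u ∈ (ThetaData.badPrimesMod D).image fun v => FinitePlace.mk (v.under (𝓞 ℚ)) :=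
  Finset.mem_image.mpr ⟨placeModOfM D u x, hx, mk_under_placeModOfM D p u hu x⟩

section Ideles

variable (r : ThetaData.IdeleData D)

include hu in
/-- **`htq1` in the finite-set shape of `settingMSharp` (instance-free form)**: at a rational place `u` that is not
below any bad prime of `F_mod`, the genuine `q`-idele has norm `1` at EVERY member of the fibre over `u`.
[cite: DupuyHilado2025, §3.3, §3.4] -/
theorem norm_tqM_eq_one_of_forall_ne (x : (thetaIndexOfInitial D).Fibre (Val.non u))
    (hS : ∀ v ∈ ThetaData.badPrimesMod D, FinitePlace.mk (v.under (𝓞 ℚ)) ≠ u) : ‖tqM D p u hu r x‖ = 1 :=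
  norm_tqM_eq_one_of_not_mem D p u hu r x (placeModOfM_not_mem_of_forall_ne D p u hu x hS)

include hu in
/-- **`ht1` in the finite-set shape (instance-free form)**: at a rational place `u` not below any bad prime, the genuine
Θ-idele has norm `1` at every member of the fibre over `u`, in every procession degree. [cite: DupuyHilado2025, §3.3, §3.4] -/
theorem norm_tThetaM_eq_one_of_forall_ne (i : Fin (thetaIndexOfInitial D).lstar)
    (x : (thetaIndexOfInitial D).Fibre (Val.non u))
    (hS : ∀ v ∈ ThetaData.badPrimesMod D, FinitePlace.mk (v.under (𝓞 ℚ)) ≠ u) : ‖tThetaM D p u hu r i x‖ = 1 :=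
  norm_tThetaM_eq_one_of_not_mem D p u hu r i x (placeModOfM_not_mem_of_forall_ne D p u hu x hS)

open scoped Classical in
include hu in
/-- **`htq1` VERBATIM in the shape `u ∉ Sq → ‖tq u x‖ = 1`** with `Sq :=` the image of `V^bad_mod` in the finite places of
`ℚ` (classical decidability on `FinitePlace ℚ` for `Finset.image`). [cite: DupuyHilado2025, §3.3, §3.4] -/
theorem norm_tqM_eq_one_of_not_mem_image (x : (thetaIndexOfInitial D).Fibre (Val.non u))
    (hS : u ∉ (ThetaData.badPrimesMod D).image fun v => FinitePlace.mk (v.under (𝓞 ℚ))) :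
    ‖tqM D p u hu r x‖ = 1 :=
  norm_tqM_eq_one_of_not_mem D p u hu r x fun hx => hS (mem_image_of_placeModOfM_mem D p u hu x hx)

open scoped Classical in
include hu in
/-- **`ht1` VERBATIM in the shape `u ∉ Sθ → ‖t u i x‖ = 1`** with `Sθ :=` the image of `V^bad_mod`.
[cite: DupuyHilado2025, §3.3, §3.4] -/
theorem norm_tThetaM_eq_one_of_not_mem_image (i : Fin (thetaIndexOfInitial D).lstar)
    (x : (thetaIndexOfInitial D).Fibre (Val.non u))
    (hS : u ∉ (ThetaData.badPrimesMod D).image fun v => FinitePlace.mk (v.under (𝓞 ℚ))) :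
    ‖tThetaM D p u hu r i x‖ = 1 :=
  norm_tThetaM_eq_one_of_not_mem D p u hu r i x fun hx => hS (mem_image_of_placeModOfM_mem D p u hu x hx)

end Ideles

include hu in
/-- `htq1` in the finite-set shape for the ideles of a volume input `I` of `D` (instance-free form).
[cite: DupuyHilado2025, §3.3, §3.4] -/
theorem norm_tqM_ideleDataOf_eq_one_of_forall_ne {I : ThetaVolumeInput (fieldOfModuli E) K}
    (hI : ThetaData.IsVolumeInputOf D I) (x : (thetaIndexOfInitial D).Fibre (Val.non u))
    (hS : ∀ v ∈ ThetaData.badPrimesMod D, FinitePlace.mk (v.under (𝓞 ℚ)) ≠ u) :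
    ‖tqM D p u hu (ideleDataOf D hI) x‖ = 1 :=
  norm_tqM_eq_one_of_forall_ne D p u hu _ x hS

include hu in
/-- `ht1` in the finite-set shape for the ideles of a volume input `I` of `D` (instance-free form).
[cite: DupuyHilado2025, §3.3, §3.4] -/
theorem norm_tThetaM_ideleDataOf_eq_one_of_forall_ne {I : ThetaVolumeInput (fieldOfModuli E) K}
    (hI : ThetaData.IsVolumeInputOf D I) (i : Fin (thetaIndexOfInitial D).lstar)
    (x : (thetaIndexOfInitial D).Fibre (Val.non u))
    (hS : ∀ v ∈ ThetaData.badPrimesMod D, FinitePlace.mk (v.under (𝓞 ℚ)) ≠ u) :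
    ‖tThetaM D p u hu (ideleDataOf D hI) i x‖ = 1 :=
  norm_tThetaM_eq_one_of_forall_ne D p u hu _ i x hS

end Summit.ABC.IUTFork.Thm311.Real

end
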